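import Summits.CriticalPhenomena.PercolationContinuityZ3.Theorems.Transplant.SkelNegBParamsRootA
import Summits.CriticalPhenomena.PercolationContinuityZ3.Theorems.Transplant.SkelNegBParamsSlotsTA
import HarnessLib

/-!
# N1 params, chain of record `NegB`, part RootA-A — the (ζ′) twin of part RootA at `A := Aof κ`: THE SEED'S FINE FOOTPRINT AT THE ROOT read by the (ζ′)
# cells — **`hkA0_RA/hkA1_RA`** (`20K s_i·(|A|·(…)·k) ≤ (k+1)·D_A` from `room_fcellsA_at`), **`RA'_le_r_TA`** (`RA′ ≤ r_i = K·s_i`, `s_i ≥ Kq(6RA′+11)`),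
# **`hkAQ_TA`** (`(k+1)+1 ≤ 5r_i`); `Mu_add_two_le_RA'`, `k_add_two_le_RA'`, `hclrz_T` of part RootA are cell-free and reused.  (stmt-g16 2026-08-22; NEG-SCOPE §B.19 (ζ′).)
builds on p205010 (kernel theorem, internal audit signed; external expert review pending) — nothing in this file uses p205010; NOTHING is claimed about
the node `SamePDropOfSkeletonNeg₁` (OPEN).
Lane `prim-bschramm-*`, seat `prim-bschramm-stmt` (gen 16); helper file (`--supports stmt-CriticalPhenomena-4575 --as helper`); ledger HOME/prim-bschramm-stmt/NEG-PARAMS.md.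
[cite: KozmaNitzan2024, §4 Lemma 10 Step IV (p. 21), Lemma 11 (p. 22)] [cite: MartineauTassion2017, §4.3 Lemma 4.2]
-/

noncomputable section

open scoped Classical

namespace Summit.CriticalPhenomena.PercolationContinuityZ3.Theorems.Transplant

namespace PlanarSkeletonNeg

namespace NegB

open Literature.Probability.Percolation Literature.Probability.LatticeModels SimpleGraph
open SkelConc (Consts)
open Skelφ.StepI (DataN)
open Neg

/-! ## §1 The seed's footprint read by `kA := k + 1` -/

section Seed

variable (κ : Consts) {V : Type} [DecidableEq V] [Countable V] {G : SimpleGraph V} [G.LocallyFinite] (Φ : PlanarSkeletonNeg G) (t : V)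
  (p : unitInterval) (D : DataN V) (g f : ℕ)

/-- **`hkA0`** with `kA := k + 1`: `20K s₀·(|A|·(|v_β|+|v_L|)·k) ≤ (k+1)·D_A` (`c₀·A·L̂₀ + 2 ≤ D_A`). [folklore] -/
theorem hkA0_RA (hN : EqNumL κ Φ t p D g f) :
    20 * ((fcellsA κ Φ t p D g f).K : ℤ) * (((fcellsA κ Φ t p D g f).s 0 : ℕ) : ℤ) *
        (|Aof κ| * (|Skelφ.NegPrm.vβOf (nL κ Φ t p D g f) (hL κ Φ t p D g f) (ℓL κ Φ t p D g f) (vL κ Φ t p D g f)| + |vL κ Φ t p D g f|) * (D.k : ℤ)) ≤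
      ((D.k : ℤ) + 1) * Skelφ.NegPrm.DofA (Aof κ) (nL κ Φ t p D g f) (hL κ Φ t p D g f) (ℓL κ Φ t p D g f) (vL κ Φ t p D g f) := by
  have h0 := (room_fcellsA_at κ Φ t p D g f hN).1
  obtain ⟨hn1, hℓ1⟩ := one_le_of_eqNumL κ Φ t p D g f hN
  have hD : 0 < Skelφ.NegPrm.DofA (Aof κ) (nL κ Φ t p D g f) (hL κ Φ t p D g f) (ℓL κ Φ t p D g f) (vL κ Φ t p D g f) := Skelφ.NegPrm.DofA_pos (Aof_pos κ).1.ne' hn1 hℓ1 _ _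
  have e : vβL κ Φ t p D g f = Skelφ.NegPrm.vβOf (nL κ Φ t p D g f) (hL κ Φ t p D g f) (ℓL κ Φ t p D g f) (vL κ Φ t p D g f) := rfl
  rw [e] at h0
  have hk : (0 : ℤ) ≤ D.k := by positivity
  have hX : 0 ≤ 20 * ((fcellsA κ Φ t p D g f).K : ℤ) * (((fcellsA κ Φ t p D g f).s 0 : ℕ) : ℤ) *
      (|Aof κ| * (|Skelφ.NegPrm.vβOf (nL κ Φ t p D g f) (hL κ Φ t p D g f) (ℓL κ Φ t p D g f) (vL κ Φ t p D g f)| + |vL κ Φ t p D g f|)) := by positivity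
  generalize 20 * ((fcellsA κ Φ t p D g f).K : ℤ) * (((fcellsA κ Φ t p D g f).s 0 : ℕ) : ℤ) = C at h0 hX ⊢
  generalize |Aof κ| * (|Skelφ.NegPrm.vβOf (nL κ Φ t p D g f) (hL κ Φ t p D g f) (ℓL κ Φ t p D g f) (vL κ Φ t p D g f)| + |vL κ Φ t p D g f|) = X at h0 hX ⊢
  generalize Skelφ.NegPrm.DofA (Aof κ) (nL κ Φ t p D g f) (hL κ Φ t p D g f) (ℓL κ Φ t p D g f) (vL κ Φ t p D g f) = Δ at h0 hD ⊢
  generalize (D.k : ℤ) = k at hk ⊢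
  nlinarith

/-- **`hkA1`** with `kA := k + 1`: `20K s₁·(|A|·(|n_L|+|h_L|)·k) ≤ (k+1)·D_A`. [folklore] -/
theorem hkA1_RA (hN : EqNumL κ Φ t p D g f) :
    20 * ((fcellsA κ Φ t p D g f).K : ℤ) * (((fcellsA κ Φ t p D g f).s 1 : ℕ) : ℤ) * (|Aof κ| * (|((nL κ Φ t p D g f : ℕ) : ℤ)| + |hL κ Φ t p D g f|) * (D.k : ℤ)) ≤
      ((D.k : ℤ) + 1) * Skelφ.NegPrm.DofA (Aof κ) (nL κ Φ t p D g f) (hL κ Φ t p D g f) (ℓL κ Φ t p D g f) (vL κ Φ t p D g f) := by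
  have h0 := (room_fcellsA_at κ Φ t p D g f hN).2
  obtain ⟨hn1, hℓ1⟩ := one_le_of_eqNumL κ Φ t p D g f hN
  have hD : 0 < Skelφ.NegPrm.DofA (Aof κ) (nL κ Φ t p D g f) (hL κ Φ t p D g f) (ℓL κ Φ t p D g f) (vL κ Φ t p D g f) := Skelφ.NegPrm.DofA_pos (Aof_pos κ).1.ne' hn1 hℓ1 _ _
  have hk : (0 : ℤ) ≤ D.k := by positivity
  have hX : 0 ≤ 20 * ((fcellsA κ Φ t p D g f).K : ℤ) * (((fcellsA κ Φ t p D g f).s 1 : ℕ) : ℤ) * (|Aof κ| * (|((nL κ Φ t p D g f : ℕ) : ℤ)| + |hL κ Φ t p D g f|)) := by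
    positivity
  generalize 20 * ((fcellsA κ Φ t p D g f).K : ℤ) * (((fcellsA κ Φ t p D g f).s 1 : ℕ) : ℤ) = C at h0 hX ⊢
  generalize |Aof κ| * (|((nL κ Φ t p D g f : ℕ) : ℤ)| + |hL κ Φ t p D g f|) = X at h0 hX ⊢
  generalize Skelφ.NegPrm.DofA (Aof κ) (nL κ Φ t p D g f) (hL κ Φ t p D g f) (ℓL κ Φ t p D g f) (vL κ Φ t p D g f) = Δ at h0 hD ⊢
  generalize (D.k : ℤ) = k at hk ⊢
  nlinarith

end Seed

/-! ## §2 The seed read inside the root cube -/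

namespace KS

section AtT

variable (κ : Consts) {V : Type} [DecidableEq V] [Countable V] {G : SimpleGraph V} [G.LocallyFinite] (Φ : PlanarSkeletonNeg G) (t : V)
  (p : unitInterval) (D : DataN V) (mk : ℕ) (gx : Neg.FSlot) (f : ℕ)

/-- **`RA′ ≤ r_i`** at `g := gT` (`K ≥ 40`, `K·Kq·(6RA′+11) ≤ r₀`, `K·Kq·(14RA′+27) ≤ r₁`). [folklore] -/
theorem RA'_le_r_TA (hN : EqNumL κ Φ t p D (gT mk gx κ Φ t p D) f) (hκ : (hL κ Φ t p D (gT mk gx κ Φ t p D) f).natAbs ≤ 10 * nL κ Φ t p D (gT mk gx κ Φ t p D) f) :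
    ∀ i, (RA' κ Φ t p D mk : ℤ) ≤ ((fcellsA κ Φ t p D (gT mk gx κ Φ t p D) f).r i : ℤ) := by
  obtain ⟨h0, h1⟩ := r_geTA κ Φ t p D mk gx f hN hκ
  have hK : (40 : ℤ) ≤ Neg.K κ := by exact_mod_cast (Neg.forty_le_K κ).1
  have hR : (0 : ℤ) ≤ (RA' κ Φ t p D mk : ℤ) := by positivity
  have hq : (1 : ℤ) ≤ Neg.Kq κ := by exact_mod_cast Neg.one_le_Kq κ
  have h6 : (1 : ℤ) * (6 * (RA' κ Φ t p D mk : ℤ) + 11) ≤ (Neg.Kq κ : ℤ) * (6 * (RA' κ Φ t p D mk : ℤ) + 11) := mul_le_mul_of_nonneg_right hq (by linarith)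
  have h14 : (1 : ℤ) * (14 * (RA' κ Φ t p D mk : ℤ) + 27) ≤ (Neg.Kq κ : ℤ) * (14 * (RA' κ Φ t p D mk : ℤ) + 27) := mul_le_mul_of_nonneg_right hq (by linarith)
  have h0' := mul_le_mul_of_nonneg_left h6 (by linarith : (0 : ℤ) ≤ Neg.K κ)
  have h1' := mul_le_mul_of_nonneg_left h14 (by linarith : (0 : ℤ) ≤ Neg.K κ)
  intro i
  obtain rfl | rfl : i = 0 ∨ i = 1 := by fin_cases i <;> simp
  · nlinarith
  · nlinarith

/-- **`hkAQ`** with `kA := k + 1`: `(k + 1) + 1 ≤ 5·r_i` for both axes, at `g := gT` (given the seed level `k ≤ M₀`). [folklore] -/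
theorem hkAQ_TA (hN : EqNumL κ Φ t p D (gT mk gx κ Φ t p D) f) (hκ : (hL κ Φ t p D (gT mk gx κ Φ t p D) f).natAbs ≤ 10 * nL κ Φ t p D (gT mk gx κ Φ t p D) f)
    (hk : D.k ≤ D.M₀) : ∀ i, (D.k : ℤ) + 1 + 1 ≤ 5 * ((fcellsA κ Φ t p D (gT mk gx κ Φ t p D) f).r i : ℤ) := by
  intro i
  have h1 := RA'_le_r_TA κ Φ t p D mk gx f hN hκ i
  have h2 : ((D.k + 2 : ℕ) : ℤ) ≤ (RA' κ Φ t p D mk : ℤ) := by exact_mod_cast k_add_two_le_RA' κ Φ t p D mk hk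
  push_cast at h2
  have h3 : (0 : ℤ) ≤ ((fcellsA κ Φ t p D (gT mk gx κ Φ t p D) f).r i : ℤ) := by positivity
  linarith

end AtT

end KS

end NegB

end PlanarSkeletonNeg

end Summit.CriticalPhenomena.PercolationContinuityZ3.Theorems.Transplant

end
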